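import Literature.Probability.LatticeModels.CollarLegModelConfigs
import Literature.Probability.Percolation.BKWFreePiece

/-!
# Stub `stub_realisability` of line `rainbow-monomials-in-excursion-kernels` — Part 1:
# the Baxter–Kelland–Wu sum at `q = 1` over the piece of a collar domain
# (crux `BoundaryDefectGaussianR`, stmt-CriticalPhenomena-14132)

The registered stub (eventual positivity of `‖Zins‖/‖Z‖` for flat separated admissible rainbow
data) needs the closed-collar dictionary **D1**: `(ofDomain V).Z = 2^{|E|}` for the
`Δ = -1/2` height model `Literature.Probability.LatticeModels.CollarLegModel` on a hole-free
domain `V ⊂ ℤ²` (its denominator; also the input of the cluster-locality stub). Parts 1–3 prove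
D1 by bridging the HEIGHT language of `CollarLegModel` (cells of `ℤ × ℤ`) with the ARROW
language of the tree's Baxter–Kelland–Wu files `BKWOrientationExpansion` / `BKWFreePiece`
(corners over a piece `Λ : Finset (Site 2)`). Throughout, the piece is any `Λ` with
`x ∈ Λ ↔ (x 0, x 1) ∈ V` (hypothesis `hΛ`; `Λ = V.image fun v ↦ ![v.1, v.2]`), so that no new
definition is introduced.

* this Part: the dictionary between coded edges `(u, dir)` of `SixVertex` and lattice edges of
  `Site 2` (`pieceEdges_eq_image`, `image_cTgt_eq_image`), the BKW identity at `q = 1`, `κ = 0`: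
  `∑_{s : corners → Bool} W_Λ(s) = 2^{|E(V)|}` (`sum_bkwWeight_one`; loop weight
  `e^{iπ/3} + e^{-iπ/3} = 1`), and the unfolding of the closed collar `ofDomain V` (cells,
  frozen edges, validity at a corner pair);
* Part 2: heights ↦ arrows and the weight matching `weight h = W_Λ(arrows h)`, injectivity;
* Part 3: on a hole-free `V` every orientation of the loops is a gradient (heights = signed sums
  of the combinatorial winding numbers `MedialTrail.wnd` of the loops), hence D1.

Registered sub-goal carried here: `s9_bkwSumOne`.
-/

noncomputable section

namespace Summit.CriticalPhenomena.CardyFormulaZ2.Cruxes.BoundaryDefectGaussianR.RainbowMonomialsInExcursionKernels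

open Finset Literature.Probability.LatticeModels Literature.Probability.Percolation
open Literature.Probability.Percolation.BKW Literature.Probability.LatticeModels.CollarLegModel

/-! ### Coordinates `ℤ × ℤ ↔ Site 2` -/

/-- `v ↦ ![v.1, v.2]` is injective. [folklore] -/
theorem vec_injective : Function.Injective fun v : ℤ × ℤ => (![v.1, v.2] : Site 2) := fun v w h => by
  have h0 := congrFun h 0
  have h1 := congrFun h 1
  simp only [Matrix.cons_val_zero, Matrix.cons_val_one, Matrix.cons_val_fin_one] at h0 h1
  exact Prod.ext h0 h1

/-- The four unit steps `cornerUnit k` in `ℤ × ℤ` coordinates. [folklore] -/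
theorem vec_add_cornerUnit (v : ℤ × ℤ) (k : Fin 4) :
    (![v.1, v.2] : Site 2) + cornerUnit k =
      ![(![(v.1 + 1, v.2), (v.1, v.2 + 1), (v.1 - 1, v.2), (v.1, v.2 - 1)] k).1,
        (![(v.1 + 1, v.2), (v.1, v.2 + 1), (v.1 - 1, v.2), (v.1, v.2 - 1)] k).2] := by
  funext i; fin_cases k <;> fin_cases i <;> simp [cornerUnit] <;> ring

/-- The far endpoint of a coded edge, unfolded. [folklore] -/
theorem edgeTip_eq (e : (ℤ × ℤ) × Bool) :
    SixVertex.edgeTip e = if e.2 then (e.1.1, e.1.2 + 1) else (e.1.1 + 1, e.1.2) := rfl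

/-- The far endpoint of a coded edge is one unit step away, east (`0`) or north (`1`). [folklore] -/
theorem vec_edgeTip (e : (ℤ × ℤ) × Bool) :
    (![(SixVertex.edgeTip e).1, (SixVertex.edgeTip e).2] : Site 2) = ![e.1.1, e.1.2] + cornerUnit (if e.2 then 1 else 0) := by
  rw [edgeTip_eq, vec_add_cornerUnit]
  cases e.2 <;> simp

/-- The coding `e ↦ {u, tip}` of edges is injective. [folklore] -/
theorem edge_injective : Function.Injective fun e : (ℤ × ℤ) × Bool =>
    (s(![e.1.1, e.1.2], ![(SixVertex.edgeTip e).1, (SixVertex.edgeTip e).2]) : Sym2 (Site 2)) := by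
  rintro ⟨u, b⟩ ⟨v, c⟩ h
  rcases Sym2.eq_iff.1 h with ⟨h1, h2⟩ | ⟨h1, h2⟩
  · have hu : u = v := vec_injective h1
    subst hu
    have h3 := vec_injective h2
    simp only [edgeTip_eq] at h3
    cases b <;> cases c <;> simp at h3 ⊢
  · have h3 := vec_injective h1
    have h4 := vec_injective h2
    simp only [edgeTip_eq] at h3 h4
    cases b <;> cases c <;> simp [Prod.ext_iff] at h3 h4 ⊢ <;> omega

/-- The two endpoints of a coded edge are adjacent in `ℤ²`. [folklore] -/
theorem zdGraph_adj_edge (e : (ℤ × ℤ) × Bool) :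
    (zdGraph 2).Adj (![e.1.1, e.1.2] : Site 2) ![(SixVertex.edgeTip e).1, (SixVertex.edgeTip e).2] := by
  rw [zdGraph_adj_iff, vec_edgeTip]
  cases e.2
  · exact ⟨0, Or.inl rfl⟩
  · exact ⟨1, Or.inl rfl⟩

/-- Every unit step of `Site 2` is a coded edge, in one of its two orientations. [folklore] -/
theorem exists_edge_of_adj {x y : Site 2} (h : (zdGraph 2).Adj x y) :
    ∃ e : (ℤ × ℤ) × Bool, (s(![e.1.1, e.1.2], ![(SixVertex.edgeTip e).1, (SixVertex.edgeTip e).2]) : Sym2 (Site 2)) = s(x, y) ∧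
      ((e.1 = (x 0, x 1) ∧ SixVertex.edgeTip e = (y 0, y 1)) ∨ (e.1 = (y 0, y 1) ∧ SixVertex.edgeTip e = (x 0, x 1))) := by
  have key : ∀ {x y : Site 2} (i : Fin 2), y = x + Pi.single i 1 →
      (![(x 0, x 1).1, (x 0, x 1).2] : Site 2) = x ∧
      (![(SixVertex.edgeTip ((x 0, x 1), decide (i = 1))).1, (SixVertex.edgeTip ((x 0, x 1), decide (i = 1))).2] : Site 2) = y ∧
        SixVertex.edgeTip ((x 0, x 1), decide (i = 1)) = (y 0, y 1) := by
    intro x y i hy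
    subst hy
    refine ⟨by funext j; fin_cases j <;> rfl, ?_, ?_⟩
    · rw [vec_edgeTip]
      fin_cases i <;> (funext j; fin_cases j <;> simp [cornerUnit])
    · fin_cases i <;> simp [edgeTip_eq]
  rw [zdGraph_adj_iff] at h
  obtain ⟨i, h | h⟩ := h
  · obtain ⟨k1, k2, k3⟩ := key i h
    exact ⟨((x 0, x 1), decide (i = 1)), by rw [k1, k2], Or.inl ⟨rfl, k3⟩⟩
  · obtain ⟨k1, k2, k3⟩ := key i h
    exact ⟨((y 0, y 1), decide (i = 1)), by rw [k1, k2, Sym2.eq_swap], Or.inr ⟨rfl, k3⟩⟩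

section Piece

variable {V : Finset (ℤ × ℤ)} {Λ : Finset (Site 2)} (hΛ : ∀ x : Site 2, x ∈ Λ ↔ (x 0, x 1) ∈ V)
include hΛ

/-- Membership in the piece, `ℤ × ℤ` side. [folklore] -/
theorem vec_mem_iff (v : ℤ × ℤ) : (![v.1, v.2] : Site 2) ∈ Λ ↔ v ∈ V := by
  rw [hΛ]; simp

/-- **The piece edges of `Λ` are the images of the live edges `inducedEdges V`.** [folklore] -/
theorem pieceEdges_eq_image : pieceEdges Λ =
    (inducedEdges V).image fun e => (s(![e.1.1, e.1.2], ![(SixVertex.edgeTip e).1, (SixVertex.edgeTip e).2]) : Sym2 (Site 2)) := by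
  ext e
  rw [mem_pieceEdges_iff, mem_image]
  constructor
  · rintro ⟨e', he', rfl⟩
    induction e' using Sym2.ind with
    | h u v =>
      rw [SimpleGraph.mem_edgeFinset, SimpleGraph.mem_edgeSet, SimpleGraph.comap_adj] at he'
      obtain ⟨e, he, h⟩ := exists_edge_of_adj he'
      refine ⟨e, ?_, by rw [he, Sym2.map_mk]⟩
      rw [inducedEdges, mem_filter]
      have hu := (hΛ _).1 u.2
      have hv := (hΛ _).1 v.2
      rcases h with ⟨h1, h2⟩ | ⟨h1, h2⟩
      · refine ⟨SixVertex.mem_edges_of_mem (h1 ▸ hu) ?_, h1 ▸ hu, h2 ▸ hv⟩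
        rw [SixVertex.mem_vertexEdges_iff]; exact Or.inl rfl
      · refine ⟨SixVertex.mem_edges_of_mem (h1 ▸ hv) ?_, h1 ▸ hv, h2 ▸ hu⟩
        rw [SixVertex.mem_vertexEdges_iff]; exact Or.inl rfl
  · rintro ⟨e', he', rfl⟩
    rw [inducedEdges, mem_filter] at he'
    refine ⟨s(⟨_, (vec_mem_iff hΛ _).2 he'.2.1⟩, ⟨_, (vec_mem_iff hΛ _).2 he'.2.2⟩), ?_, by rw [Sym2.map_mk]⟩
    rw [SimpleGraph.mem_edgeFinset, SimpleGraph.mem_edgeSet, SimpleGraph.comap_adj]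
    exact zdGraph_adj_edge e'

omit hΛ in
/-- A coded edge is the target of the corner at its first endpoint with face index `dir + 3`. [folklore] -/
theorem edge_eq_cTgt_fst (e : (ℤ × ℤ) × Bool) :
    (s(![e.1.1, e.1.2], ![(SixVertex.edgeTip e).1, (SixVertex.edgeTip e).2]) : Sym2 (Site 2)) =
      cTgt (![e.1.1, e.1.2], (if e.2 then 1 else 0 : Fin 4) + 3) := by
  have hj : ∀ j : Fin 4, j + 3 + 1 = j := by decide
  rw [cTgt, vec_edgeTip, hj]

omit hΛ in
/-- A coded edge is the target of the corner at its far endpoint with face index `dir + 1`. [folklore] -/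
theorem edge_eq_cTgt_snd (e : (ℤ × ℤ) × Bool) :
    (s(![e.1.1, e.1.2], ![(SixVertex.edgeTip e).1, (SixVertex.edgeTip e).2]) : Sym2 (Site 2)) =
      cTgt (![(SixVertex.edgeTip e).1, (SixVertex.edgeTip e).2], (if e.2 then 1 else 0 : Fin 4) + 1) := by
  rw [cTgt, vec_edgeTip, Sym2.eq_swap]
  congr 1
  cases e.2
  · simp only [Bool.false_eq_true, ↓reduceIte]
    rw [show ((0 : Fin 4) + 1 + 1) = 0 + 2 from rfl, cornerUnit_add_two]; abel
  · simp only [↓reduceIte]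
    rw [show ((1 : Fin 4) + 1 + 1) = 1 + 2 from rfl, cornerUnit_add_two]; abel

/-- **The target edges of the corners over `Λ` are the images of the edges at `V`.** [folklore] -/
theorem image_cTgt_eq_image : (univ.image fun c : ↥(cornerSet Λ) => cTgt (c : Site 2 × Fin 4)) =
    (SixVertex.edges V).image fun e => (s(![e.1.1, e.1.2], ![(SixVertex.edgeTip e).1, (SixVertex.edgeTip e).2]) : Sym2 (Site 2)) := by
  ext e
  simp only [mem_image, mem_univ, true_and]
  constructor
  · rintro ⟨c, rfl⟩
    have hc : ((c : Site 2 × Fin 4).1 0, (c : Site 2 × Fin 4).1 1) ∈ V := (hΛ _).1 (mem_cornerSet.1 c.2)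
    have hadj : (zdGraph 2).Adj (c : Site 2 × Fin 4).1 ((c : Site 2 × Fin 4).1 + cornerUnit ((c : Site 2 × Fin 4).2 + 1)) :=
      (SimpleGraph.mem_edgeSet (G := zdGraph 2)).1 (cTgt_mem_edgeSet _)
    obtain ⟨e, he, h⟩ := exists_edge_of_adj hadj
    refine ⟨e, ?_, by rw [he]; rfl⟩
    rcases h with ⟨h1, -⟩ | ⟨-, h2⟩
    · exact SixVertex.mem_edges_of_mem (h1 ▸ hc) ((SixVertex.mem_vertexEdges_iff _ _).2 (Or.inl rfl))
    · exact SixVertex.mem_edges_of_mem (h2 ▸ hc) ((SixVertex.mem_vertexEdges_iff _ _).2 (Or.inr rfl))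
  · rintro ⟨e', he', rfl⟩
    rw [SixVertex.edges, mem_biUnion] at he'
    obtain ⟨v, hv, hev⟩ := he'
    rw [SixVertex.mem_vertexEdges_iff] at hev
    rcases hev with rfl | rfl
    · exact ⟨⟨_, mem_cornerSet.2 ((vec_mem_iff hΛ _).2 hv)⟩, (edge_eq_cTgt_fst e').symm⟩
    · exact ⟨⟨_, mem_cornerSet.2 ((vec_mem_iff hΛ _).2 hv)⟩, (edge_eq_cTgt_snd e').symm⟩

/-- The boundary target edges of `Λ` are the images of the exterior edges of `V`. [folklore] -/
theorem image_cTgt_sdiff_pieceEdges : (univ.image fun c : ↥(cornerSet Λ) => cTgt (c : Site 2 × Fin 4)) \ pieceEdges Λ =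
    (SixVertex.edges V \ inducedEdges V).image fun e =>
      (s(![e.1.1, e.1.2], ![(SixVertex.edgeTip e).1, (SixVertex.edgeTip e).2]) : Sym2 (Site 2)) := by
  rw [image_cTgt_eq_image hΛ, pieceEdges_eq_image hΛ, image_sdiff_of_injOn edge_injective.injOn]
  exact filter_subset _ _

/-- A coded edge is a piece edge of `Λ` iff it is a live edge of `V`. [folklore] -/
theorem edge_mem_pieceEdges_iff {e : (ℤ × ℤ) × Bool} :
    (s(![e.1.1, e.1.2], ![(SixVertex.edgeTip e).1, (SixVertex.edgeTip e).2]) : Sym2 (Site 2)) ∈ pieceEdges Λ ↔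
      e ∈ inducedEdges V := by
  rw [pieceEdges_eq_image hΛ, mem_image]
  constructor
  · rintro ⟨e', he', h⟩
    rwa [← edge_injective h]
  · exact fun h => ⟨e, h, rfl⟩

/-- `|E(G_Λ)| = |inducedEdges V|`. [folklore] -/
theorem card_edgeFinset_piece : (finsetGraph (zdGraph 2) Λ).edgeFinset.card = (inducedEdges V).card := by
  have h1 : (pieceEdges Λ).card = (finsetGraph (zdGraph 2) Λ).edgeFinset.card :=
    card_image_of_injective _ (Sym2.map.injective Subtype.val_injective)
  rw [← h1, pieceEdges_eq_image hΛ, card_image_of_injective _ edge_injective]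

/-- **The BKW identity at `q = 1`, `κ = 0` on the piece of a collar domain**:
`∑_s W_Λ(s) = 2^{|E(V)|}` — every loop carries `e^{iπ/3} + e^{-iπ/3} = 1`, so the
arrow-configuration sum counts the bond configurations of `V`. [cite: BaxterKellandWu1976, §3–§4] -/
theorem sum_bkwWeight_one : ∑ s : ↥(cornerSet Λ) → Bool,
    bkwWeight (finsetGraph (zdGraph 2) Λ).edgeFinset.powerset (pieceCornerPerm Λ) (pieceTurn Λ) 1 s =
      (2 : ℂ) ^ (inducedEdges V).card := by
  have h := bkw_free_piece (Λ := Λ) (q := 1) one_pos (by norm_num) (fun _ => 0)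
  simp only [mul_zero, cosMu_zero one_pos (by norm_num : (1 : ℝ) ≤ 4), Finset.prod_const_one, mul_one,
    Real.sqrt_one, one_pow, Finset.sum_const, Finset.card_powerset, nsmul_eq_mul,
    Complex.ofReal_zero, Complex.exp_zero] at h
  rw [← card_edgeFinset_piece hΛ, ← h]
  push_cast
  ring

end Piece

/-! ### The closed collar `ofDomain V`: cells and unfolding -/

variable {V : Finset (ℤ × ℤ)}

/-- The closed collar has no ghosts: its vertex-cells are `V`. [folklore] -/
theorem vertexCells_ofDomain (V : Finset (ℤ × ℤ)) : (ofDomain V).vertexCells = V := by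
  rw [vertexCells, (ofDomain_cells V).2.2.1, union_empty]; rfl

/-- Every vertex of `V` is a free vertex-cell of the closed collar. [folklore] -/
theorem mem_freeCells_false_ofDomain {x : ℤ × ℤ} : (x, false) ∈ (ofDomain V).freeCells ↔ x ∈ V := by
  rw [mem_freeCells_false, freeVerts]
  show x ∈ V \ ∅ ↔ x ∈ V
  rw [sdiff_empty]

/-- The free face-cells of the closed collar are the interior faces. [folklore] -/
theorem mem_freeCells_true_ofDomain {f : ℤ × ℤ} : (f, true) ∈ (ofDomain V).freeCells ↔ f ∈ interiorFaces V := by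
  rw [mem_freeCells_true, freeFaces, (ofDomain_cells V).2.1, union_empty]; rfl

/-- Collar faces (and junk faces) of the closed collar are at height `0`. [folklore] -/
theorem hf_ofDomain_of_not_mem (h : ↥(ofDomain V).freeCells → ℤ) {f : ℤ × ℤ} (hf : f ∉ interiorFaces V) :
    (ofDomain V).hf h f = 0 := by
  rw [hf_of_not_mem _ _ (fun h' => hf (mem_freeCells_true_ofDomain.1 h'))]; rfl

/-- The frozen edges of the closed collar are the exterior edges of `V`. [folklore] -/
theorem frozenEdges_ofDomain (V : Finset (ℤ × ℤ)) : (ofDomain V).frozenEdges = SixVertex.edges V \ inducedEdges V := by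
  rw [frozenEdges, vertexCells_ofDomain]; rfl

/-- The closed collar has no open frozen edge: every frozen weight is a closed weight. [folklore] -/
theorem frozenWeight_ofDomain (h : ↥(ofDomain V).freeCells → ℤ) (e : (ℤ × ℤ) × Bool) :
    (ofDomain V).frozenWeight h e = (ofDomain V).closedWeight h e := by
  simp [frozenWeight, (ofDomain_cells V).2.2.2]

/-- The `k`-th face around `a` (counter-clockwise from the north-east one) has `a` as a corner. [folklore] -/
theorem face_mem_vertexFaces (a : ℤ × ℤ) (k : Fin 4) :
    ![a, (a.1 - 1, a.2), (a.1 - 1, a.2 - 1), (a.1, a.2 - 1)] k ∈ SixVertex.vertexFaces a := by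
  fin_cases k <;> simp [SixVertex.vertexFaces]

/-- The faces at a vertex are the four faces `k = 0, 1, 2, 3` around it. [folklore] -/
theorem mem_vertexFaces_iff {v f : ℤ × ℤ} :
    f ∈ SixVertex.vertexFaces v ↔ ∃ k : Fin 4, f = ![v, (v.1 - 1, v.2), (v.1 - 1, v.2 - 1), (v.1, v.2 - 1)] k := by
  constructor
  · intro h
    simp only [SixVertex.vertexFaces, mem_insert, mem_singleton] at h
    rcases h with rfl | rfl | rfl | rfl
    · exact ⟨0, rfl⟩
    · exact ⟨1, rfl⟩
    · exact ⟨3, rfl⟩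
    · exact ⟨2, rfl⟩
  · rintro ⟨k, rfl⟩; exact face_mem_vertexFaces v k

/-- The `k`-th face around `![a.1, a.2]` in the tree's `cFace` indexing is the `k`-th face around `a`. [folklore] -/
theorem cFace_vec (a : ℤ × ℤ) (k : Fin 4) :
    cFace ((![a.1, a.2] : Site 2), k) = ![(![a, (a.1 - 1, a.2), (a.1 - 1, a.2 - 1), (a.1, a.2 - 1)] k).1,
      (![a, (a.1 - 1, a.2), (a.1 - 1, a.2 - 1), (a.1, a.2 - 1)] k).2] := by
  funext i; fin_cases k <;> fin_cases i <;> simp [cFace, faceAt, cornerOff]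

/-- **Validity at a corner pair of the closed collar**: `|h(a) - h(face_k a)| = 1`. [folklore] -/
theorem abs_sub_eq_one_of_valid {h : ↥(ofDomain V).freeCells → ℤ} (hval : (ofDomain V).IsValid h)
    {a : ℤ × ℤ} (ha : a ∈ V) (k : Fin 4) :
    |(ofDomain V).hv h a - (ofDomain V).hf h (![a, (a.1 - 1, a.2), (a.1 - 1, a.2 - 1), (a.1, a.2 - 1)] k)| = 1 :=
  hval a (by rw [vertexCells_ofDomain]; exact ha) _ (face_mem_vertexFaces a k)
    (mem_biUnion.2 ⟨a, ha, face_mem_vertexFaces a k⟩) (Or.inl (mem_freeCells_false_ofDomain.2 ha))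

/-! ### Registered sub-goal of this Part -/

/-- **Sub-goal `s9_bkwSumOne`** (registered on stmt-CriticalPhenomena-14132): the Baxter–Kelland–Wu
identity at `q = 1` on the piece of a collar domain — the sum over all arrow configurations of the
corners over `Λ(V)` of the six-vertex weight `W_Λ` equals `2^{|inducedEdges V|}`, the number of
bond configurations (loop weight `e^{iπ/3} + e^{-iπ/3} = 1`). [cite: BaxterKellandWu1976, §3–§4] -/
theorem s9_bkwSumOne : ∀ V : Finset (ℤ × ℤ), ∑ s : ↥(Literature.Probability.Percolation.cornerSet (V.image fun v : ℤ × ℤ => (![v.1, v.2] : Literature.Probability.LatticeModels.Site 2))) → Bool, Literature.Probability.Percolation.BKW.bkwWeight (Literature.Probability.LatticeModels.finsetGraph (Literature.Probability.LatticeModels.zdGraph 2) (V.image fun v : ℤ × ℤ => (![v.1, v.2] : Literature.Probability.LatticeModels.Site 2))).edgeFinset.powerset (Literature.Probability.Percolation.pieceCornerPerm (V.image fun v : ℤ × ℤ => (![v.1, v.2] : Literature.Probability.LatticeModels.Site 2))) (Literature.Probability.Percolation.pieceTurn (V.image fun v : ℤ × ℤ => (![v.1, v.2] : Literature.Probability.LatticeModels.Site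 2))) 1 s = (2 : ℂ) ^ (Literature.Probability.LatticeModels.CollarLegModel.inducedEdges V).card := by
  intro V
  refine sum_bkwWeight_one (V := V) fun x => ?_
  rw [mem_image]
  constructor
  · rintro ⟨v, hv, rfl⟩; simpa using hv
  · intro h; exact ⟨_, h, by funext j; fin_cases j <;> rfl⟩

end Summit.CriticalPhenomena.CardyFormulaZ2.Cruxes.BoundaryDefectGaussianR.RainbowMonomialsInExcursionKernels

end
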